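import Summits.AtomisticToContinuum.HydrodynamicLimit.Theorems.JParityClosureLocalSecondLawEquilibriumDefs
import Summits.AtomisticToContinuum.HydrodynamicLimit.Theorems.PolynomialCompression.Negative.PdeForm
import Literature.MathematicalPhysics.KineticTheory.HardSphereUniformGas

/-!
# Equilibrium stub `eq_pinning`: the `t = 0` tie pins the Euler datum to the constant state `(1, ū, Θ)`

Registered stub of the equilibrium side-composition of line `exact-entropy-ledger-three-passivities` for the crux
`JParityClosure.LocalSecondLaw` (stmt-AtomisticToContinuum-13081, lead c2).  Under the homogeneous local Gibbs law
`lawC σ a Θ ū` (constant activity `a`, drift `ū`, temperature `Θ`) the crux's `t = 0` hypothesis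
`TendstoHydroFieldsAt (fun N => lawC σ a Θ ū N (Φ N)) Φ ρ u θ 0` forces `ρ 0 ≡ 1`, `u 0 ≡ ū`, `θ 0 ≡ Θ` for every
classical hard-sphere Euler solution `(ρ, u, θ)` on `[0, T)`, `0 < T`, below a threshold `σ₁(a, ū, Θ)`.

Proof (all ingredients are landed tree facts, imported, not restated):
* `PolynomialCompressionPDE.lln_rhoLim` — below `σ₁ ≤ 1/2` the statics package `SmallDensity (profileOf a) σ` holds
  and the local Gibbs fields converge at `t = 0`, through every flow family, to `(rhoLim (profileOf a) σ, ū, Θ)`;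
* `PolynomialCompressionPDE.tendstoHydroFieldsAt_zero_iff_flowFree` + `PolynomialCompressionPDE.data_eq_of_flowFree`
  — uniqueness of limits in probability, field by field (density; momentum coordinatewise; energy divided by
  `rhoLim > 0`), pins continuous time-`0` slices: `ρ 0 = rhoLim`, `u 0 = ū`, `θ 0 = Θ`; the slices are continuous by
  `PolynomialCompressionPDE.continuous_slices_zero`;
* `profileOf_const` + `rhoLim_uniform` — for constant activity the profile is the uniform one and `rhoLim ≡ 1`.

References: H. Spohn, *Large Scale Dynamics of Interacting Particles* (1991), Part I §2.3, §3 (local equilibrium,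
statics of the hard-sphere gas at small density, uniqueness of the hydrodynamic datum).
-/

noncomputable section

namespace Summit.AtomisticToContinuum.HydrodynamicLimit.Theorems.LocalSecondLawEquilibrium

open scoped BigOperators Topology Classical MeasureTheory ENNReal InnerProductSpace
open Filter Set MeasureTheory
open Literature.MathematicalPhysics.KineticTheory
open Literature.Analysis.FluidPDE
open Summit.AtomisticToContinuum.HydrodynamicLimit.Theorems.LocalSecondLawNegative
open Summit.AtomisticToContinuum.HydrodynamicLimit.Theorems.LocalSecondLawLedger
open Summit.AtomisticToContinuum.HydrodynamicLimit.Theorems.PolynomialCompressionPDE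

/-- **Registered stub `eq_pinning`** (line `exact-entropy-ledger-three-passivities`, equilibrium side
composition) · data pinning at global equilibrium. For `0 < a`, `0 < Θ`, `ū` there is `σ₁ > 0` such that for
`0 < σ < σ₁`, every classical hard-sphere Euler solution on `[0, T)`, `0 < T`, tied at `t = 0` to the homogeneous
local Gibbs laws `lawC σ a Θ ū` through some flow family has the constant datum `(ρ, u, θ)(0, ·) = (1, ū, Θ)`
(uniqueness of limits in probability against the identified homogeneous law of large numbers). [folklore] -/
theorem eq_pinning :
  ∀ (a Θ : ℝ) (ū : V3), 0 < a → 0 < Θ → ∃ σ₁ : ℝ, 0 < σ₁ ∧ ∀ σ : ℝ, 0 < σ → σ < σ₁ →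
    ∀ (T : ℝ) (ρ θ : ℝ → T3 → ℝ) (u : ℝ → T3 → V3), IsHardSphereEulerSolution σ T ρ u θ → 0 < T →
    ∀ Φ : (N : ℕ) → Flow σ N, TendstoHydroFieldsAt (fun N => lawC σ a Θ ū N (Φ N)) Φ ρ u θ 0 →
    (∀ x, ρ 0 x = 1) ∧ (∀ x, u 0 x = ū) ∧ (∀ x, θ 0 x = Θ) := by
  intro a Θ ū ha hΘ
  obtain ⟨σ₁, hσ₁, hσ₁2, H⟩ := lln_rhoLim (a₀ := fun _ : T3 => a) (θ₀ := fun _ : T3 => Θ)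
    (u₀ := fun _ : T3 => ū) continuous_const continuous_const continuous_const (fun _ => ha) (fun _ => hΘ)
  refine ⟨σ₁, hσ₁, fun σ hσ hσlt T ρ θ u hE hT Φ hA => ?_⟩
  obtain ⟨h, hpos, Hσ⟩ := H σ hσ hσlt
  have hσ2 : σ ≤ 1 / 2 := (hσlt.trans_le hσ₁2).le
  obtain ⟨hρc, huc, hθc⟩ := continuous_slices_zero hE hT
  have hlln := (tendstoHydroFieldsAt_zero_iff_flowFree Φ).1 (Hσ Φ).2
  have hAff := (tendstoHydroFieldsAt_zero_iff_flowFree Φ).1 hA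
  obtain ⟨hρ, hu, hθ⟩ := data_eq_of_flowFree (a₀ := fun _ : T3 => a) (θ₀ := fun _ : T3 => Θ)
    (u₀ := fun _ : T3 => ū) continuous_const continuous_const continuous_const (fun _ => ha) (fun _ => hΘ) hσ2
    h.continuous_rhoLim (fun x => h.rhoLim_pos (hpos x)) hlln hρc huc hθc hAff
  have hunif : SmallDensity uniformProfile σ := by
    rw [← profileOf_const ha]
    exact h
  refine ⟨fun x => ?_, fun x => ?_, fun x => ?_⟩
  · rw [hρ, profileOf_const ha]
    exact rhoLim_uniform hunif x
  · rw [hu]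
  · rw [hθ]

end Summit.AtomisticToContinuum.HydrodynamicLimit.Theorems.LocalSecondLawEquilibrium

end
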